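import Mathlib.GroupTheory.Sylow
import Mathlib.GroupTheory.Index
import Mathlib.GroupTheory.PGroup
import Mathlib.GroupTheory.SpecificGroups.Cyclic
import HarnessLib

/-!
# DisagreementBeurling — `DefectTable36`, part 1: groups of order 36 with trivial centre

Pure group theory for the proof of the support item
`Summit.Langlands.Langlands.Theses.DisagreementBeurling.DefectTable36` (stmt-Langlands-13936).
Let `H` be a finite group with `|H| = 36`, `Z(H) = 1` and an element `x` of order `4`.

* §1 the Sylow `3`-subgroup `P` (order `9`) is normal: two distinct Sylow `3`-subgroups `P ≠ P'`
  meet in `D = P ∩ P' ≠ 1` (`[H : D] ≤ 16`); both are abelian, so both centralise `D`, and the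
  centraliser `C` of `D` is proper (`Z(H) = 1`) of order `9` or `18`; the relative-index bound
  `[C : D] ≤ [C : P] · [C : P']` then forces `|D| ≥ 5`, impossible;
* §2 `H = ⋃ xʲ P` (coset decomposition with exponent reduced mod `4`).

The inversion of `P` by `x²` and the fourth-power law for `H ∖ P` follow in part 2
(`DisagreementBeurlingDefectTable36Inv`).

No named facts are assumed. [folklore]
-/

set_option linter.dupNamespace false

namespace Summit.Langlands.Langlands.Theorems.DisagreementBeurlingDefectTable36

variable {H : Type*} [Group H]

/-! ### §1 The Sylow `3`-subgroup of a group of order `36` with trivial centre is normal -/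

section Sylow

/-- A Sylow `3`-subgroup of a group of order `36` has order `9`. [folklore] -/
theorem card_sylow_three_eq_nine [Finite H] (h36 : Nat.card H = 36) (P : Sylow 3 H) :
    Nat.card (P : Subgroup H) = 9 := by
  haveI : Fact (Nat.Prime 3) := ⟨Nat.prime_three⟩
  obtain ⟨k, hk⟩ := P.isPGroup'.exists_card_eq
  have h9 : 3 ^ 2 ∣ Nat.card (P : Subgroup H) :=
    P.pow_dvd_card_of_pow_dvd_card (by rw [h36]; norm_num)
  have hdvd : Nat.card (P : Subgroup H) ∣ 36 := h36 ▸ (P : Subgroup H).card_subgroup_dvd_card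
  rw [hk] at h9 hdvd ⊢
  have hk2 : 2 ≤ k := (Nat.pow_dvd_pow_iff_le_right (by norm_num)).mp h9
  have hk3 : k < 3 := by
    by_contra hge
    push Not at hge
    have h27 : 3 ^ 3 ∣ 36 := (Nat.pow_dvd_pow 3 hge).trans hdvd
    norm_num at h27
  interval_cases k
  rfl

/-- A subgroup of order `9` has index `4` in a group of order `36`. [folklore] -/
theorem index_eq_four_of_card_eq_nine (h36 : Nat.card H = 36) {P : Subgroup H}
    (hP : Nat.card P = 9) : P.index = 4 := by
  have := P.card_mul_index
  rw [hP, h36] at this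
  omega

/-- In a group of order `9 = 3²` any two elements commute. [folklore] -/
theorem comm_of_card_eq_nine {P : Subgroup H} (hP : Nat.card P = 9) {a b : H} (ha : a ∈ P)
    (hb : b ∈ P) : a * b = b * a := by
  haveI : Fact (Nat.Prime 3) := ⟨Nat.prime_three⟩
  have h := (IsPGroup.isMulCommutative_of_card_eq_prime_sq (p := 3) (G := P)
    (by rw [hP]; norm_num)).is_comm.comm ⟨a, ha⟩ ⟨b, hb⟩
  simpa using congrArg Subtype.val h

/-- **Normality of the Sylow `3`-subgroup.**  In a group of order `36` with trivial centre every
Sylow `3`-subgroup is normal. [folklore] -/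
theorem sylow_three_normal [Finite H] (h36 : Nat.card H = 36) (hZ : Subgroup.center H = ⊥) (P : Sylow 3 H) :
    (P : Subgroup H).Normal := by
  haveI : Fact (Nat.Prime 3) := ⟨Nat.prime_three⟩
  have hP9 := card_sylow_three_eq_nine h36 P
  by_contra hnot
  -- a conjugate `P' ≠ P`
  have hex : ∃ g : H, g • P ≠ P := by
    by_contra hall
    push Not at hall
    apply hnot
    rw [← Subgroup.normalizer_eq_top_iff, eq_top_iff]
    intro g _
    exact Sylow.smul_eq_iff_mem_normalizer.mp (hall g)
  obtain ⟨g, hg⟩ := hex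
  set P' : Sylow 3 H := g • P with hP'def
  have hP'9 := card_sylow_three_eq_nine h36 P'
  have hne : (P' : Subgroup H) ≠ P := fun h => hg (Sylow.ext h)
  have hPi := index_eq_four_of_card_eq_nine h36 hP9
  have hP'i := index_eq_four_of_card_eq_nine h36 hP'9
  -- `D = P ⊓ P'` is nontrivial
  set D : Subgroup H := (P : Subgroup H) ⊓ (P' : Subgroup H) with hDdef
  have hidx : D.index ≤ 16 := by
    have := Subgroup.index_inf_le (H := (P : Subgroup H)) (K := (P' : Subgroup H))
    rw [hPi, hP'i] at this
    exact this
  have hDdvd : Nat.card D ∣ 9 := hP9 ▸ Subgroup.card_dvd_of_le inf_le_left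
  have hD9 : Nat.card D ≠ 9 := by
    intro h9
    have hDeq : D = (P : Subgroup H) :=
      Subgroup.eq_of_le_of_card_ge inf_le_left (by rw [h9, hP9])
    have hle : (P : Subgroup H) ≤ (P' : Subgroup H) := hDeq ▸ inf_le_right
    exact hne (Subgroup.eq_of_le_of_card_ge hle (by rw [hP9, hP'9])).symm
  have hDmul := D.card_mul_index
  rw [h36] at hDmul
  have hD13 : Nat.card D = 1 ∨ Nat.card D = 3 := by
    have hDdvd' : Nat.card D ∣ 3 ^ 2 := by simpa using hDdvd
    obtain ⟨k, hk, hkD⟩ := (Nat.dvd_prime_pow Nat.prime_three).mp hDdvd'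
    interval_cases k
    · left; simpa using hkD
    · right; simpa using hkD
    · exact absurd hkD (by simpa using hD9)
  -- the centraliser of `D` contains `P` and `P'`
  set C : Subgroup H := Subgroup.centralizer (D : Set H) with hCdef
  have hPC : (P : Subgroup H) ≤ C := by
    intro a ha
    rw [Subgroup.mem_centralizer_iff]
    intro d hd
    exact comm_of_card_eq_nine hP9 ((inf_le_left : D ≤ P) hd) ha
  have hP'C : (P' : Subgroup H) ≤ C := by
    intro a ha
    rw [Subgroup.mem_centralizer_iff]
    intro d hd
    exact comm_of_card_eq_nine hP'9 ((inf_le_right : D ≤ P') hd) ha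
  -- and is proper, since the centre is trivial and `D ≠ 1`
  have hCtop : C ≠ ⊤ := by
    intro hC
    have hsub : (D : Set H) ⊆ Subgroup.center H := Subgroup.centralizer_eq_top_iff_subset.mp hC
    rw [hZ] at hsub
    have hDbot : D = ⊥ := by
      rw [eq_bot_iff]
      intro d hd
      exact hsub hd
    have : D.index = 36 := by rw [hDbot, Subgroup.index_bot, h36]
    omega
  have h9C : 9 ∣ Nat.card C := hP9 ▸ Subgroup.card_dvd_of_le hPC
  have hC36 : Nat.card C ∣ 36 := h36 ▸ C.card_subgroup_dvd_card
  have hCne : Nat.card C ≠ 36 := fun h => hCtop (Subgroup.eq_top_of_card_eq C (by rw [h, h36]))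
  have hCmul := C.card_mul_index
  rw [h36] at hCmul
  -- relative indices inside `C`
  have hrel : D.relIndex C ≤ (P : Subgroup H).relIndex C * (P' : Subgroup H).relIndex C :=
    Subgroup.relIndex_inf_le
  have hPrel : (P : Subgroup H).relIndex C * C.index = 4 := by
    rw [Subgroup.relIndex_mul_index hPC, hPi]
  have hP'rel : (P' : Subgroup H).relIndex C * C.index = 4 := by
    rw [Subgroup.relIndex_mul_index hP'C, hP'i]
  have hDrel : D.relIndex C * C.index = D.index :=
    Subgroup.relIndex_mul_index (le_trans inf_le_left hPC)
  -- `Nat.card C = 9 m` with `m ∣ 4`, `m ≠ 4`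
  obtain ⟨m, hm⟩ := h9C
  have hm4 : m ∣ 4 := by
    have : 9 * m ∣ 9 * 4 := by rw [← hm]; simpa using hC36
    exact Nat.dvd_of_mul_dvd_mul_left (by norm_num) this
  have hmle : m ≤ 4 := Nat.le_of_dvd (by norm_num) hm4
  have hCi : C.index * (9 * m) = 36 := by rw [← hm, mul_comm]; exact hCmul
  interval_cases m
  · omega
  · -- `|C| = 9`: `C.index = 4`, both relative indices are `1`
    have hci : C.index = 4 := by omega
    rw [hci] at hPrel hP'rel hDrel
    have h1 : (P : Subgroup H).relIndex C = 1 := by omega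
    have h1' : (P' : Subgroup H).relIndex C = 1 := by omega
    rw [h1, h1'] at hrel
    have : D.index ≤ 4 := by omega
    rcases hD13 with h | h <;> rw [h] at hDmul <;> omega
  · -- `|C| = 18`: `C.index = 2`, both relative indices are `2`
    have hci : C.index = 2 := by omega
    rw [hci] at hPrel hP'rel hDrel
    have h1 : (P : Subgroup H).relIndex C = 2 := by omega
    have h1' : (P' : Subgroup H).relIndex C = 2 := by omega
    rw [h1, h1'] at hrel
    have : D.index ≤ 8 := by omega
    rcases hD13 with h | h <;> rw [h] at hDmul <;> omega
  · omega
  · omega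

/-- **The normal subgroup of order `9`.**  A group of order `36` with trivial centre has a normal
subgroup of order `9` (its Sylow `3`-subgroup), in which any two elements commute. [folklore] -/
theorem exists_normal_card_nine [Finite H] (h36 : Nat.card H = 36) (hZ : Subgroup.center H = ⊥) :
    ∃ P : Subgroup H, P.Normal ∧ Nat.card P = 9 := by
  haveI : Fact (Nat.Prime 3) := ⟨Nat.prime_three⟩
  obtain ⟨P⟩ := (inferInstance : Nonempty (Sylow 3 H))
  exact ⟨P, sylow_three_normal h36 hZ P, card_sylow_three_eq_nine h36 P⟩

end Sylow

/-! ### §2 Cosets of the normal subgroup of order `9` and an element of order `4` -/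

section Cosets

/-- Elements of a subgroup of order `9` have order dividing `9`. [folklore] -/
theorem pow_nine_eq_one_of_mem {P : Subgroup H} (hP9 : Nat.card P = 9) {p : H} (hp : p ∈ P) :
    p ^ 9 = 1 := by
  have h := pow_card_eq_one' (G := P) (x := ⟨p, hp⟩)
  rw [hP9] at h
  simpa using congrArg Subtype.val h

/-- The square of an element of order `4` does not lie in a subgroup of order `9`. [folklore] -/
theorem sq_not_mem_of_orderOf_eq_four {P : Subgroup H} (hP9 : Nat.card P = 9) {x : H}
    (hx : orderOf x = 4) : x ^ 2 ∉ P := by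
  intro h
  have h18 : x ^ 18 = 1 := by
    rw [show (18 : ℕ) = 2 * 9 by norm_num, pow_mul]
    exact pow_nine_eq_one_of_mem hP9 h
  have := orderOf_dvd_of_pow_eq_one h18
  rw [hx] at this
  omega

/-- **Coset decomposition.**  If `|H| = 36`, `P ⊴ H` has order `9` and `x` has order `4`, then
every element of `H` is `xᵏ p` with `p ∈ P`. [folklore] -/
theorem exists_zpow_mul [Finite H] (h36 : Nat.card H = 36) {P : Subgroup H} (hN : P.Normal)
    (hP9 : Nat.card P = 9) {x : H} (hx : orderOf x = 4) (h : H) :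
    ∃ (k : ℤ) (p : H), p ∈ P ∧ h = x ^ k * p := by
  have hQ : Nat.card (H ⧸ P) = 4 := by
    rw [← Subgroup.index_eq_card]
    exact index_eq_four_of_card_eq_nine h36 hP9
  have hx2 : x ^ 2 ∉ P := sq_not_mem_of_orderOf_eq_four hP9 hx
  have h4 : (x : H ⧸ P) ^ 4 = 1 := by
    rw [← QuotientGroup.mk_pow, ← hx, pow_orderOf_eq_one]
    simp
  have h2 : (x : H ⧸ P) ^ 2 ≠ 1 := by
    rw [← QuotientGroup.mk_pow, ne_eq, QuotientGroup.eq_one_iff]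
    exact hx2
  have hox : orderOf (x : H ⧸ P) = 4 := by
    have hdvd : orderOf (x : H ⧸ P) ∣ 2 ^ 2 := by simpa using orderOf_dvd_of_pow_eq_one h4
    obtain ⟨k, hk, hko⟩ := (Nat.dvd_prime_pow Nat.prime_two).mp hdvd
    interval_cases k
    · exfalso
      apply h2
      rw [pow_zero, orderOf_eq_one_iff] at hko
      rw [hko, one_pow]
    · exfalso
      apply h2
      have := pow_orderOf_eq_one (x : H ⧸ P)
      rwa [hko, pow_one] at this
    · simpa using hko
  have htop : Subgroup.zpowers (x : H ⧸ P) = ⊤ :=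
    Subgroup.eq_top_of_card_eq _ (by rw [Nat.card_zpowers, hox, hQ])
  have hmem : (h : H ⧸ P) ∈ Subgroup.zpowers (x : H ⧸ P) := by
    rw [htop]
    exact Subgroup.mem_top _
  obtain ⟨k, hk⟩ := Subgroup.mem_zpowers_iff.mp hmem
  rw [← QuotientGroup.mk_zpow, QuotientGroup.eq] at hk
  exact ⟨k, (x ^ k)⁻¹ * h, hk, by group⟩

/-- **Coset decomposition, natural exponent.**  As `exists_zpow_mul`, with the exponent reduced
modulo `4`. [folklore] -/
theorem exists_pow_mul [Finite H] (h36 : Nat.card H = 36) {P : Subgroup H} (hN : P.Normal)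
    (hP9 : Nat.card P = 9) {x : H} (hx : orderOf x = 4) (h : H) :
    ∃ (n : ℕ) (p : H), n < 4 ∧ p ∈ P ∧ h = x ^ n * p := by
  obtain ⟨k, p, hp, rfl⟩ := exists_zpow_mul h36 hN hP9 hx h
  have hk : x ^ k = x ^ (k % 4) := by
    have := zpow_mod_orderOf x k
    rw [hx] at this
    exact_mod_cast this.symm
  obtain ⟨n, hn⟩ := Int.eq_ofNat_of_zero_le (Int.emod_nonneg k (by norm_num : (4 : ℤ) ≠ 0))
  have hn4 : n < 4 := by
    have := Int.emod_lt_of_pos k (by norm_num : (0 : ℤ) < 4)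
    omega
  refine ⟨n, p, hn4, hp, ?_⟩
  rw [hk, hn, zpow_natCast]

end Cosets

end Summit.Langlands.Langlands.Theorems.DisagreementBeurlingDefectTable36
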